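import Summits.ResolutionOfSingularities.ResolutionOfSingularities.Theorems.HilbertSamuelEliminationSigmaMaxModificationsCorridor3WLadderIsoInsepE2InitialForm
import HarnessLib

/-!
# [OURS · L1 W4.2] E2 chart calculus, brick 19a: «THE SUCCESSOR SHAPE `ĉ(y₀² + λ̂y₁²) + y₃·G` WITH `λ̂` A NON-SQUARE HAS `e ≤ d − 2`»
# — the directrix count behind the NO-JUMP row `IsoInsepE2SuccInsep₂` (crux chain w42, cell k2 `T3insep` = `stub_isoInsepTower`;
# `--supports stmt-ResolutionOfSingularities-19249`)

OURS (cell res-hironaka, slot W4.2, seat res-D-pv-042; OWN OBJECT TUO 2026-08-27 18:19Z, (N4b) = the NJ row of the NJ/RC dictionary);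
NOT a statement of [Hironaka2017] nor of [CossartJannsenSaito2020] / [CossartPiltant2008]. AI-drafted, weaker than expert review.
PROOF file, def-free, fact-free.

* `dirDim_add_two_le_of_shape` — `R` regular local with regular parameters `y` (`emb.dim = d`), `σ : R ↠ A` onto a noetherian local ring
  of residue characteristic two, `ker σ = (h)`, `h ∈ 𝔪² ∖ 𝔪³`, and `h = ĉ·(y_{i₀}² + λ̂·y_{i₁}²) + y_{i₃}·G` with `ĉ` a unit, `λ̂` NOT a
  square modulo `𝔪`, `G ∈ 𝔪`, `i₀, i₁, i₃` distinct ⇒ **`e(A) + 2 ≤ d`**. Proof: the initial form is `F = c̄(Y₀² + λ̄Y₁²) + Y₃·ℓ` pushed to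
  `κ(A)` (LEMMA T `E1Free.exists_tangentConeIdeal_eq_map_span_singleton`, `dirDim_eq'`); if `e(A) ≥ d − 1` then `τ({F}) ≤ 1`
  (`hironakaTau_eq_of_directrixDim_span_singleton`), `F` is cross-free (brick 1 `coeff_add_single_eq_zero_of_hironakaTau_le_one`), its
  invariance space `𝕎 = {F(w) = 0}` has dimension `≥ d − 1` (`hironakaTau_add_finrank_invarianceSpace`) yet meets the plane
  `⟨e_{i₀}, e_{i₁}⟩` trivially (`c̄(α² + λ̄β²) = 0 ⇒ β = 0 ⇒ α = 0`, `λ̄` not a square) — so `dim 𝕎 ≤ d − 2`, contradiction.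

## References

* V. Cossart, U. Jannsen, S. Saito, LNM 2270 (2020): Def. 2.18, Def. 2.26. [CossartJannsenSaito2020]
* V. Cossart, O. Piltant, J. Algebra 320 (2008), proof of Prop. 4.2 (`τ`, invariance space). [CossartPiltant2008]
-/

noncomputable section

set_option linter.dupNamespace false

open scoped Classical
open IsLocalRing MvPolynomial Module
open Literature.RingTheory.MvPolynomial Literature.RingTheory.HilbertSamuel Literature.AlgebraicGeometry.Resolution
open Summit.ResolutionOfSingularities.ResolutionOfSingularities.Theorems.SigmaMaxModificationsCorridor3

universe u

namespace Summit.ResolutionOfSingularities.ResolutionOfSingularities.Cruxes.SigmaMaxModifications.IdeasL1C6.E2Chart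

/-- **`e ≤ d − 2` FOR THE SUCCESSOR SHAPE.** `R` regular local with regular parameters `y : Fin d → R`, `σ : R ↠ A` onto a noetherian local
ring of residue characteristic two with `ker σ = (h)`, `h ∈ 𝔪² ∖ 𝔪³`; if `h = ĉ·(u² + λ̂·v²) + t·G` with `u = y_{i₀}`, `v = y_{i₁}`,
`t = y_{i₃}` (`i₀, i₁, i₃` pairwise distinct), `ĉ ∉ 𝔪`, `w² − λ̂ ∉ 𝔪` for all `w` and `G ∈ 𝔪`, then `dirDim A + 2 ≤ d`. [OURS · L1 W4.2 · k2 · E2 chart calculus, brick 19a]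
[folklore] -/
theorem dirDim_add_two_le_of_shape {R A : Type u} [CommRing R] [IsRegularLocalRing R] [CommRing A] [IsLocalRing A]
    [IsNoetherianRing A] [CharP (ResidueField A) 2] {d : ℕ} (hd : (maximalIdeal R).spanFinrank = d) (y : Fin d → R)
    (hy : Ideal.span (Set.range y) = maximalIdeal R) (σ : R →+* A) (hσ : Function.Surjective σ) {h : R}
    (hker : RingHom.ker σ = Ideal.span {h}) (h2 : h ∈ maximalIdeal R ^ 2) (h3 : h ∉ maximalIdeal R ^ (2 + 1))
    {i₀ i₁ i₃ : Fin d} (h01 : i₀ ≠ i₁) (h03 : i₀ ≠ i₃) (h13 : i₁ ≠ i₃) {u v t cc lam G : R} (hyu : y i₀ = u) (hyv : y i₁ = v)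
    (hyt : y i₃ = t) (hcc : cc ∉ maximalIdeal R) (hlam : ∀ w : R, w ^ 2 - lam ∉ maximalIdeal R) (hG : G ∈ maximalIdeal R)
    (hshape : h = cc * (u ^ 2 + lam * v ^ 2) + t * G) : dirDim A + 2 ≤ d := by
  subst hyu hyv hyt
  haveI := IsLocalHom.of_surjective σ hσ
  haveI : CharP (ResidueField R) 2 := ((ResidueField.map σ).charP_iff_charP 2).mpr inferInstance
  -- coordinates of `G` in the regular parameters
  have hG' : G ∈ Ideal.span (Set.range y) := by rw [hy]; exact hG
  obtain ⟨aa, haa⟩ := Ideal.mem_span_range_iff_exists_fun.mp hG'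
  -- the degree-two form presenting `h`
  set Φ : MvPolynomial (Fin d) R := C cc * (X i₀ ^ 2 + C lam * X i₁ ^ 2) + X i₃ * (∑ k, C (aa k) * X k) with hΦ
  have hℓ : (∑ k, C (aa k) * X k : MvPolynomial (Fin d) R).IsHomogeneous 1 :=
    IsHomogeneous.sum _ _ _ fun k _ => by simpa using (isHomogeneous_C (Fin d) (aa k)).mul (isHomogeneous_X R k)
  have hΦhom : Φ.IsHomogeneous 2 := by
    have h1 : (X i₀ ^ 2 : MvPolynomial (Fin d) R).IsHomogeneous 2 := by simpa using (isHomogeneous_X R i₀).pow 2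
    have h2' : (C lam * X i₁ ^ 2 : MvPolynomial (Fin d) R).IsHomogeneous 2 := by
      simpa using (isHomogeneous_C (Fin d) lam).mul ((isHomogeneous_X R i₁).pow 2)
    have h3' : (C cc * (X i₀ ^ 2 + C lam * X i₁ ^ 2) : MvPolynomial (Fin d) R).IsHomogeneous 2 := by
      simpa using (isHomogeneous_C (Fin d) cc).mul (h1.add h2')
    have h4' : (X i₃ * (∑ k, C (aa k) * X k) : MvPolynomial (Fin d) R).IsHomogeneous 2 := by
      simpa using (isHomogeneous_X R i₃).mul hℓ
    exact h3'.add h4'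
  have hℓeval : MvPolynomial.eval y (∑ k, C (aa k) * X k) = ∑ k, aa k * y k := by
    rw [map_sum]
    exact Finset.sum_congr rfl fun k _ => by rw [map_mul, eval_C, eval_X]
  have hΦeval : MvPolynomial.eval y Φ = h := by
    rw [hshape, hΦ, map_add, map_mul, map_mul, map_add, map_mul, map_pow, map_pow, eval_C, eval_C, eval_X, eval_X, eval_X, hℓeval,
      haa]
  have hF : MvPolynomial.map (residue R) Φ ∈ initialFormsOf y h 2 := ⟨Φ, hΦhom, hΦeval, rfl⟩
  -- over `κ(A)`
  have hσy : Ideal.span (Set.range (σ ∘ y)) = maximalIdeal A := E1Free.span_range_comp_eq_maximalIdeal hy σ hσ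
  obtain ⟨κ, hκ, hJ⟩ := E1Free.exists_tangentConeIdeal_eq_map_span_singleton hd y hy σ hσ hker h2 h3 hF hσy
  have hd1 : 1 ≤ d := Nat.succ_le_of_lt (Fin.pos i₀)
  have hdA : (maximalIdeal A).spanFinrank = d := E1Free.spanFinrank_maximalIdeal_eq_of_presentation hd σ hσ hker le_rfl h2 h3 hd1
  set Gf := MvPolynomial.map κ (MvPolynomial.map (residue R) Φ) with hGf
  rw [map_span_singleton_mvPolynomial] at hJ
  have hGhom : Gf.IsHomogeneous 2 := (isHomogeneous_of_mem_initialFormsOf y hF).map κ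
  have hdir : dirDim A = directrixDim (Ideal.span {Gf}) := by rw [dirDim_eq' A hdA (σ ∘ y) hσy, hJ]
  -- the shape of `Gf` and its values
  have hGfshape : Gf = C (κ (residue R cc)) * (X i₀ ^ 2 + C (κ (residue R lam)) * X i₁ ^ 2) + X i₃ * (∑ k, C (κ (residue R (aa k))) * X k) := by
    rw [hGf, hΦ]
    simp only [map_add, map_mul, map_pow, map_sum, map_C, map_X]
  have heval : ∀ w : Fin d → ResidueField A,
      MvPolynomial.eval w Gf = κ (residue R cc) * (w i₀ ^ 2 + κ (residue R lam) * w i₁ ^ 2) + w i₃ * ∑ k, κ (residue R (aa k)) * w k := by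
    intro w
    rw [hGfshape]
    simp only [map_add, map_mul, map_pow, map_sum, eval_C, eval_X]
  have hc'0 : κ (residue R cc) ≠ 0 := by
    rw [map_ne_zero_iff _ hκ.1, Ne, residue_eq_zero_iff]
    exact hcc
  have hl'sq : ∀ μ : ResidueField A, μ ^ 2 ≠ κ (residue R lam) := by
    intro μ hμ
    obtain ⟨μ₀, rfl⟩ := hκ.2 μ
    obtain ⟨w₀, rfl⟩ := Ideal.Quotient.mk_surjective (I := maximalIdeal R) μ₀
    apply hlam w₀
    rw [← residue_eq_zero_iff, map_sub, map_pow, sub_eq_zero]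
    apply hκ.1
    rw [map_pow]
    exact hμ
  have hG0 : Gf ≠ 0 := by
    intro h0
    have h1 := heval (Pi.single i₀ 1)
    rw [h0, map_zero, Pi.single_eq_same, Pi.single_eq_of_ne h01.symm, Pi.single_eq_of_ne h03.symm] at h1
    simp only [one_pow, zero_pow two_ne_zero, mul_zero, add_zero, mul_one, zero_mul] at h1
    exact hc'0 h1.symm
  -- suppose `e(A) ≥ d − 1`: then `τ ≤ 1`
  by_contra hlt
  have hτ : hironakaTau (ResidueField A) ({Gf} : Set (MvPolynomial (Fin d) (ResidueField A))) ≤ 1 := by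
    rw [hironakaTau_eq_of_directrixDim_span_singleton hGhom hG0 hdir.symm]
    omega
  have hcross : ∀ i j : Fin d, i ≠ j → coeff (Finsupp.single i 1 + Finsupp.single j 1) Gf = 0 :=
    fun i j hij => coeff_add_single_eq_zero_of_hironakaTau_le_one hτ hij
  -- the invariance space is the zero set of `Gf`, of dimension `≥ d − 1`
  have hW : ∀ w : Fin d → ResidueField A,
      w ∈ invarianceSpace (ResidueField A) ({Gf} : Set (MvPolynomial (Fin d) (ResidueField A))) ↔ MvPolynomial.eval w Gf = 0 :=
    fun w => by rw [mem_invarianceSpace_iff_of_cross_eq_zero hGhom hcross w, ← eval_eq_sum_of_cross_eq_zero hGhom hcross w]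
  have hdimW : d ≤ finrank (ResidueField A) (invarianceSpace (ResidueField A)
      ({Gf} : Set (MvPolynomial (Fin d) (ResidueField A)))) + 1 := by
    have := hironakaTau_add_finrank_invarianceSpace (ResidueField A) ({Gf} : Set (MvPolynomial (Fin d) (ResidueField A)))
    omega
  -- … but it meets the plane `⟨e_{i₀}, e_{i₁}⟩` trivially
  set U : Submodule (ResidueField A) (Fin d → ResidueField A) :=
    Submodule.span (ResidueField A) (Set.range ![(Pi.single i₀ 1 : Fin d → ResidueField A), Pi.single i₁ 1]) with hU
  have hli : LinearIndependent (ResidueField A) ![(Pi.single i₀ 1 : Fin d → ResidueField A), Pi.single i₁ 1] := by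
    rw [LinearIndependent.pair_iff]
    intro s t hst
    have h0 := congr_fun hst i₀
    have h1 := congr_fun hst i₁
    simp only [Pi.add_apply, Pi.smul_apply, Pi.single_eq_same, Pi.single_eq_of_ne h01, Pi.single_eq_of_ne h01.symm,
      smul_eq_mul, mul_one, mul_zero, add_zero, zero_add, Pi.zero_apply] at h0 h1
    exact ⟨h0, h1⟩
  have hU2 : finrank (ResidueField A) U = 2 := by
    rw [hU, finrank_span_eq_card hli, Fintype.card_fin]
  have hinf : U ⊓ invarianceSpace (ResidueField A) ({Gf} : Set (MvPolynomial (Fin d) (ResidueField A))) = ⊥ := by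
    rw [Submodule.eq_bot_iff]
    rintro w ⟨hwU, hwW⟩
    obtain ⟨cf, rfl⟩ := (Submodule.mem_span_range_iff_exists_fun (ResidueField A)).mp hwU
    have hev := (hW _).mp hwW
    rw [heval] at hev
    simp only [Fin.sum_univ_two, Matrix.cons_val_zero, Matrix.cons_val_one, Pi.add_apply, Pi.smul_apply,
      Pi.single_eq_same, Pi.single_eq_of_ne h01, Pi.single_eq_of_ne h01.symm, Pi.single_eq_of_ne h03.symm,
      Pi.single_eq_of_ne h13.symm, smul_eq_mul, mul_one, mul_zero, add_zero, zero_add, zero_mul] at hev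
    -- `hev : c̄ * (cf 0 ^ 2 + λ̄ * cf 1 ^ 2) = 0`
    have hq : cf 0 ^ 2 + κ (residue R lam) * cf 1 ^ 2 = 0 := (mul_eq_zero.mp hev).resolve_left hc'0
    by_cases hβ : cf 1 = 0
    · rw [hβ] at hq
      simp only [zero_pow two_ne_zero, mul_zero, add_zero, pow_eq_zero_iff two_ne_zero] at hq
      simp [Fin.sum_univ_two, hq, hβ]
    · exfalso
      apply hl'sq (cf 0 / cf 1)
      have h2 : cf 0 ^ 2 = κ (residue R lam) * cf 1 ^ 2 := by
        have := eq_neg_of_add_eq_zero_left hq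
        rwa [CharTwo.neg_eq] at this
      rw [div_pow, h2, mul_div_assoc, div_self (pow_ne_zero 2 hβ), mul_one]
  have hsum := Submodule.finrank_sup_add_finrank_inf_eq U
    (invarianceSpace (ResidueField A) ({Gf} : Set (MvPolynomial (Fin d) (ResidueField A))))
  rw [hinf, finrank_bot, add_zero, hU2] at hsum
  have hle := Submodule.finrank_le (U ⊔ invarianceSpace (ResidueField A) ({Gf} : Set (MvPolynomial (Fin d) (ResidueField A))))
  rw [Module.finrank_fin_fun] at hle
  omega

end Summit.ResolutionOfSingularities.ResolutionOfSingularities.Cruxes.SigmaMaxModifications.IdeasL1C6.E2Chart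

end
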